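/-
Copyright (c) 2026 the pub-hodgecm-mathlib formalisation cell (harness21).  Prover seat hodgecm-mathlib-R90-C131-p05 (g0), HCML SLAB R90-TF,
section S4 «Ch. 13.1–2» (dealer K2E2-plan (g6)), ROAD «KEYS2-ANALYTIC» (MEMO `R90/R90-C131-p05/g0/MEMO-KEYS2-analytic-road.v1.md`), brick (ε2)
FILE C «ANNULUS VANISHING» (the head).  2026-09-04/05.
-/
import Summits.HodgeConjecture.HodgeConjecture.Theorems.R90S4Keys2TailVanishing      -- ★ (this seat) (ε2) FILE B: `integral_annulus_tail_eq_zero_of_norm_two`; brings ★ FILE A (tail, norm balls)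
import Summits.HodgeConjecture.HodgeConjecture.Theorems.R90S4Keys2CellFunFarOut      -- ★ (this seat) (ε1) FILE B: `exists_toFun_weylElt_mul_eq_mul_toFun_one_two`
import Summits.HodgeConjecture.HodgeConjecture.Theorems.F0P3cStCharTSKeys3TorusConjBall -- ★ §2 generic: `setIntegral_ball_sub_setIntegral_ball_of_le/ge`, `setIntegral_preimage_eq_integral_indicator_comp`
import Summits.HodgeConjecture.HodgeConjecture.Theorems.F0P3cStCharTSKeys3AnnulusVanishing -- ★ (N = 3 twin): `threshold_le`, `threshold_le_div`
import Literature.NumberTheory.Automorphic.SmoothIndOpenCellHaarFunctional               -- ★ `SmoothInd.continuous_cellFun`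
import HarnessLib

/-!
# R90-TF · S4 — ROAD «KEYS2-ANALYTIC», brick (ε2) FILE C «ANNULUS VANISHING ON `U(Φ₂)(L⁺_v)`»: for EVERY vector `f ∈ i((χ₁, χ₂))` (`v` non-split,
# `χ₁|F_v^× = ω_{E/F}`), every unit `α` (`Q = ‖α‖`) and every large `A`: `∫_{K_{A/Q²}} f(w₀ u) dμ − ∫_{K_A} f(w₀ u) dμ = 0`, `K_B = {u ∈ N₂ : nrm u₀₁ ≤ B}`

Cell `hodgecm-mathlib`, crux H413 (`stmt-HodgeConjecture-24833`, lane `--supports … --as helper`), route of record `HCCMUnconditional` (no route verbs;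
count-neutral).  Programme R90-TF, section S4 (Rogawski Ch. 13.1–2, base `R90-C131`); seat R90-C131-p05 (g0).  THEOREMS ONLY (no `def`, no instance,
no notation, no named fact, no `sorry`); imports ★ only.  The `N = 2` twin of ★ `F0P3cStCharTSKeys3AnnulusVanishing.exists_forall_setIntegral_normBall_sub_eq_zero`,
for ANY Haar measure of `N₂(L⁺_v)`.

THE MATHEMATICS ([Rogawski1990, §11.1, §12.1]; [Keys1984, §3, §7]; [Casselman1995, §6.3–6.4]).  The difference of the two ball integrals is `±` the integral of the cell
function `F(u) = f(w₀ u)` over an annulus `{A/Q² < nrm u₀₁ ≤ A}` (or `{A < nrm u₀₁ ≤ A/Q²}` when `Q < 1`; ★ TorusConjBall §2).  Far out (★ (ε1) FILE B) `F(u) =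
(χ₂(−1) f(1)) · T(u₀₁)` with the tail `T(b) = (√nrm b)⁻¹ χ₁(σ b̂)⁻¹` of ★ (ε2) FILE A, so the annulus integral is `(χ₂(−1) f(1)) · I(A/Q², A)`, and `Q² = ‖σ(α) α‖` is the
module of a NORM: ★ (ε2) FILE B «TAIL VANISHING» kills it (`α` for `Q > 1`, `α⁻¹` for `Q < 1`; nothing to do for `Q = 1`).  In the assembly (ζ) `α = d₀` for
`m = diag(d₀, d̄₀⁻¹) ∈ T₂`, `m⁻¹ K_A m = K_{A/‖d₀‖²}`, and ★ B5's annulus formula turns this into `r_B(m)[f₀] = χ(m)[f₀]`, i.e. the Jacquet module of `i((χ₁, χ₂))` is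
semisimple at the l.d.s. point — the reducibility (RED).
* `coe_inv_halfModulusChar_eq_inv_sqrt` (`‖b̂‖^{-1/2} = (√nrm b)⁻¹`), **`exists_forall_setIntegral_normBall_sub_eq_zero_two`** (the head).
HONEST LABEL: HC_CM is proved only modulo the 7 printed citations (2 remaining named inputs: hLiu418 = stmt-HodgeConjecture-24832,
h413 = stmt-HodgeConjecture-24833) until rung 0 closes; organ-level computation, closes nothing by itself; count-neutral.

## References
* [Rogawski1990] J. D. Rogawski, *Automorphic Representations of Unitary Groups in Three Variables*, Ann. of Math. Stud. 123 (1990), §11.1 p. 161, §12.1 p. 171.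
* [Keys1984] D. Keys, *Principal series representations of special unitary groups over local fields*, Compositio Math. 51 (1984), §3, §7 Thm. (1).
* [Casselman1995] W. Casselman, *Introduction to the theory of admissible representations of 𝔭-adic reductive groups* (1995), §6.3, §6.4.
-/

set_option autoImplicit false
-- the mandated namespace (brief §3.4) repeats the single-problem summit's segment (`HodgeConjecture.HodgeConjecture`)
set_option linter.dupNamespace false

noncomputable section

open NumberField IsDedekindDomain MeasureTheory Measure Topology Filter Set
open scoped Matrix MatrixGroups NNReal ENNReal
open Literature.NumberTheory.Automorphic Literature.NumberTheory.Automorphic.UnitaryGroup Literature.NumberTheory.Automorphic.UnitaryGroup.HeisRing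
open Literature.NumberTheory.GaloisRepresentations Literature.NumberTheory.GaloisRepresentations.IsNonarchimedeanLocalField
open Summit.HodgeConjecture.HodgeConjecture.Cruxes.H413.F0P3cStCharTSLocalRingNormDictionary
open Summit.HodgeConjecture.HodgeConjecture.Cruxes.H413.F0P3cStCharTSKeys3TorusConjBall
open Summit.HodgeConjecture.HodgeConjecture.Cruxes.H413.F0P3cStCharTSBigCellFactorisation (neg_one_mem_normOneUnits)

namespace Summit.HodgeConjecture.HodgeConjecture.R90.S4

variable (L : Type) [Field L] [NumberField L] [IsCMField L] (v : HeightOneSpectrum (𝓞 ↥(maximalRealSubfield L)))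
  (w : PlacesOver L v) (hw : IsCMField.complexConj L • w.1 = w.1)

omit [IsCMField L] in
/-- **`‖b̂‖^{-1/2} = (√nrm b)⁻¹`**: the inverse half-modulus of the unit `b̂` over a unit `b`, read in `ℂ`, is the scalar of the tail `T` (★ `coe_halfModulusChar_apply`,
★ `unitModulusChar_localRing_eq_prod`). [cite: Rogawski1990, §12.1 p. 171] -/
theorem coe_inv_halfModulusChar_eq_inv_sqrt {b : LocalRing L v} (hb : IsUnit b) :
    (((halfModulusChar (LocalRing L v) hb.unit)⁻¹ : ℂˣ) : ℂ) =
      (((NNReal.sqrt (∏ w' : PlacesOver L v, normAbs (w'.1.adicCompletion L) (b w')))⁻¹ : ℝ≥0) : ℂ) := by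
  have hmod : unitModulusChar (LocalRing L v) hb.unit = ∏ w' : PlacesOver L v, normAbs (w'.1.adicCompletion L) (b w') := by
    rw [unitModulusChar_localRing_eq_prod, hb.unit_spec]
  rw [Units.val_inv_eq_inv_val, coe_halfModulusChar_apply, hmod, NNReal.coe_inv, Complex.ofReal_inv]

variable (hns : ∀ w : PlacesOver L v, IsCMField.complexConj L • w.1 = w.1)
  (χ₁ : (LocalRing L v)ˣ →* ℂˣ) (χ₂ : ↥(normOneUnits (conjLocal L (IsCMField.complexConj L) v)) →* ℂˣ)
  (w₀ : ↥(unitaryGroupOfForm (conjLocal L (IsCMField.complexConj L) v) (cmLocalForm L 2 v)))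
  (hw₀ : Units.val (w₀ : GL (Fin 2) (LocalRing L v)) = cmLocalForm L 2 v)

include hw hns hw₀ in
open scoped Classical in
set_option synthInstance.maxHeartbeats 400000 in
set_option maxHeartbeats 3200000 in
-- statement∕proof-heavy: the `SmoothInd` carrier of ★ `cmPrincipalSeries` (class of ★ (ε1) `exists_toFun_weylElt_mul_eq_mul_toFun_one_two`)
/-- **«ANNULUS VANISHING ON `U(Φ₂)(L⁺_v)`★».**  `v` non-split, `χ₁` continuous with `χ₁|F_v^× = ω_{E/F}` (`hq`), `w₀` of matrix `Φ₂`, `f` ANY vector of `i((χ₁, χ₂))`, `μ` ANY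
Haar measure of `N₂(L⁺_v)`, `α ∈ R^×` ANY unit with module `Q = ‖α‖`: there is `A₁` such that for all `A ≥ A₁`, with `K_B = {u ∈ N₂ : nrm u₀₁ ≤ B}` (`nrm = Π_{w′} |·|_{w′}`),
  `∫_{K_{A/Q²}} f(w₀ u) dμ(u) − ∫_{K_A} f(w₀ u) dμ(u) = 0`.
(For `m = diag(d₀, d̄₀⁻¹) ∈ T₂`, `m⁻¹ K_A m = K_{A/‖d₀‖²}`: this is the bracket of ★ B5's annulus formula at `α = d₀`.)  Far out ★ (ε1), the annulus integral is
`(χ₂(−1) f(1)) · I(A/Q², A)`, killed by ★ (ε2) FILE B at the norm `σ(α) α` (resp. `σ(α⁻¹) α⁻¹`). [cite: Keys1984, §3; §7 Thm. (1)] [cite: Rogawski1990, §11.1 p. 161; §12.1 p. 171]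
[cite: Casselman1995, §6.3, §6.4] -/
theorem exists_forall_setIntegral_normBall_sub_eq_zero_two [MeasurableSpace ↥(cmBorelTriple L 2 v).N] [BorelSpace ↥(cmBorelTriple L 2 v).N]
    (h₁ : Continuous fun x => ((χ₁ x : ℂˣ) : ℂ)) (hq : IsQuadraticCharExtension (conjLocal L (IsCMField.complexConj L) v) χ₁)
    (μ : Measure ↥(cmBorelTriple L 2 v).N) [μ.IsHaarMeasure] (α : (LocalRing L v)ˣ)
    (f : haveI := locallyCompactSpace_cmBorelU L 2 v
      Representation.SmoothInd (cmBorelTriple L 2 v).P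
        (Representation.twist
          (((Representation.trivial ℂ ↥(torusU (conjLocal L (IsCMField.complexConj L) v) (cmLocalForm L 2 v)) ℂ).twist
            (torusCharPair (conjLocal L (IsCMField.complexConj L) v) (cmLocalForm L 2 v) (cmLocalForm_eq_over L 2 v) 0 χ₁ χ₂)).comp
            (cmBorelTriple L 2 v).proj) (rootDeltaChar (cmBorelTriple L 2 v).P))) :
    ∃ A₁ : ℝ, ∀ A : ℝ, A₁ ≤ A →
      ∫ u in {u : ↥(cmBorelTriple L 2 v).N | ((∏ w' : PlacesOver L v, normAbs (w'.1.adicCompletion L)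
            ((Units.val ((u : ↥(unitaryGroupOfForm (conjLocal L (IsCMField.complexConj L) v) (cmLocalForm L 2 v))) : GL (Fin 2) (LocalRing L v)) 0 1) w') : ℝ≥0) : ℝ) ≤
              A / ((distribHaarChar (LocalRing L v) α : ℝ) ^ 2)},
          f.toFun ((w₀ : ↥(unitaryGroupOfForm (conjLocal L (IsCMField.complexConj L) v) (cmLocalForm L 2 v))) * u) ∂μ -
        ∫ u in {u : ↥(cmBorelTriple L 2 v).N | ((∏ w' : PlacesOver L v, normAbs (w'.1.adicCompletion L)
            ((Units.val ((u : ↥(unitaryGroupOfForm (conjLocal L (IsCMField.complexConj L) v) (cmLocalForm L 2 v))) : GL (Fin 2) (LocalRing L v)) 0 1) w') : ℝ≥0) : ℝ) ≤ A},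
          f.toFun ((w₀ : ↥(unitaryGroupOfForm (conjLocal L (IsCMField.complexConj L) v) (cmLocalForm L 2 v))) * u) ∂μ = 0 := by
  haveI := locallyCompactSpace_cmBorelU L 2 v
  haveI : LocallyCompactSpace ↥(unitaryGroupOfForm (conjLocal L (IsCMField.complexConj L) v) (cmLocalForm L 2 v)) :=
    locallyCompactSpace_local (IsCMField.complexConj L) 2 _ v
  haveI : SecondCountableTopology (LocalRing L v) := secondCountableTopology_localRing (E := L) v
  letI : MeasurableSpace (LocalRing L v) := borel _
  haveI : BorelSpace (LocalRing L v) := ⟨rfl⟩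
  have hσ := conjLocal_conjLocal_cm L v
  have hσc := continuous_conjLocal L (IsCMField.complexConj L) v
  -- the modulus `Q = ‖α‖`
  have hQpos : (0 : ℝ) < (distribHaarChar (LocalRing L v) α : ℝ) := NNReal.coe_pos.2 distribHaarChar_pos
  -- the far-out threshold of ★ (ε1)
  obtain ⟨A₀, hA₀⟩ := exists_toFun_weylElt_mul_eq_mul_toFun_one_two L v w₀ hw₀ hns χ₁ χ₂ f
  refine ⟨((A₀ : ℝ) + 1) * max 1 ((distribHaarChar (LocalRing L v) α : ℝ) ^ 2), fun A hA => ?_⟩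
  have hA1 : (A₀ : ℝ) + 1 ≤ A := Cruxes.H413.F0P3cStCharTSKeys3AnnulusVanishing.threshold_le A₀.coe_nonneg hA
  have hAQ : (A₀ : ℝ) + 1 ≤ A / (distribHaarChar (LocalRing L v) α : ℝ) ^ 2 :=
    Cruxes.H413.F0P3cStCharTSKeys3AnnulusVanishing.threshold_le_div A₀.coe_nonneg hQpos hA
  have hApos : 0 < A := by have := A₀.coe_nonneg; linarith
  have hAQpos : 0 < A / (distribHaarChar (LocalRing L v) α : ℝ) ^ 2 := div_pos hApos (pow_pos hQpos 2)
  -- measurability of the entry and its norm, continuity of the cell function, compactness of the balls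
  have hz : Continuous fun u : ↥(cmBorelTriple L 2 v).N =>
      Units.val ((u : ↥(unitaryGroupOfForm (conjLocal L (IsCMField.complexConj L) v) (cmLocalForm L 2 v))) : GL (Fin 2) (LocalRing L v)) 0 1 :=
    (Units.continuous_val.comp (continuous_subtype_val.comp continuous_subtype_val)).matrix_elem 0 1
  have hν : Measurable fun u : ↥(cmBorelTriple L 2 v).N => ((∏ w' : PlacesOver L v, normAbs (w'.1.adicCompletion L)
      ((Units.val ((u : ↥(unitaryGroupOfForm (conjLocal L (IsCMField.complexConj L) v) (cmLocalForm L 2 v))) : GL (Fin 2) (LocalRing L v)) 0 1) w') : ℝ≥0) : ℝ) :=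
    (NNReal.continuous_coe.comp ((continuous_prod_normAbs L v).comp hz)).measurable
  have hF : Continuous fun u : ↥(cmBorelTriple L 2 v).N =>
      f.toFun ((w₀ : ↥(unitaryGroupOfForm (conjLocal L (IsCMField.complexConj L) v) (cmLocalForm L 2 v))) * u) :=
    SmoothInd.continuous_cellFun (cmBorelTriple L 2 v).P _ (cmBorelTriple L 2 v).N.subtype _ continuous_subtype_val f
  have hK : ∀ B : ℝ, IsCompact {u : ↥(cmBorelTriple L 2 v).N | ((∏ w' : PlacesOver L v, normAbs (w'.1.adicCompletion L)
      ((Units.val ((u : ↥(unitaryGroupOfForm (conjLocal L (IsCMField.complexConj L) v) (cmLocalForm L 2 v))) : GL (Fin 2) (LocalRing L v)) 0 1) w') : ℝ≥0) : ℝ) ≤ B} :=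
    fun B => isCompact_normBall_two L v w hw B
  -- far out, the cell function is `(χ₂(−1) f(1)) · T(u₀₁)` (★ (ε1) FILE B + `coe_inv_halfModulusChar_eq_inv_sqrt`)
  have hfar : ∀ u : ↥(cmBorelTriple L 2 v).N, (A₀ : ℝ) + 1 ≤ ((∏ w' : PlacesOver L v, normAbs (w'.1.adicCompletion L)
      ((Units.val ((u : ↥(unitaryGroupOfForm (conjLocal L (IsCMField.complexConj L) v) (cmLocalForm L 2 v))) : GL (Fin 2) (LocalRing L v)) 0 1) w') : ℝ≥0) : ℝ) →
      f.toFun ((w₀ : ↥(unitaryGroupOfForm (conjLocal L (IsCMField.complexConj L) v) (cmLocalForm L 2 v))) * u) =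
        (fun b : LocalRing L v => (((χ₂ ⟨-1, neg_one_mem_normOneUnits (conjLocal L (IsCMField.complexConj L) v)⟩ : ℂˣ) : ℂ) * f.toFun 1) •
          ((((NNReal.sqrt (∏ w' : PlacesOver L v, normAbs (w'.1.adicCompletion L) (b w')))⁻¹ : ℝ≥0) : ℂ) *
            (fun b : LocalRing L v => if hb : IsUnit b then
              (((χ₁ (Units.map (conjLocal L (IsCMField.complexConj L) v : LocalRing L v →* LocalRing L v) hb.unit))⁻¹ : ℂˣ) : ℂ) else 0) b))
          (Units.val ((u : ↥(unitaryGroupOfForm (conjLocal L (IsCMField.complexConj L) v) (cmLocalForm L 2 v))) : GL (Fin 2) (LocalRing L v)) 0 1) := by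
    intro u hu
    have hpos : (0 : ℝ) < ((∏ w' : PlacesOver L v, normAbs (w'.1.adicCompletion L)
        ((Units.val ((u : ↥(unitaryGroupOfForm (conjLocal L (IsCMField.complexConj L) v) (cmLocalForm L 2 v))) : GL (Fin 2) (LocalRing L v)) 0 1) w') : ℝ≥0) : ℝ) := by
      have := A₀.coe_nonneg; linarith
    have hne0 : Units.val ((u : ↥(unitaryGroupOfForm (conjLocal L (IsCMField.complexConj L) v) (cmLocalForm L 2 v))) : GL (Fin 2) (LocalRing L v)) 0 1 ≠ 0 := by
      intro h0
      rw [h0, (prod_normAbs_eq_zero_iff L v w hw 0).2 rfl, NNReal.coe_zero] at hpos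
      exact lt_irrefl _ hpos
    have hb := (isUnit_iff_ne_zero_localRing L v w hw _).2 hne0
    have hmod : unitModulusChar (LocalRing L v) hb.unit = ∏ w' : PlacesOver L v, normAbs (w'.1.adicCompletion L)
        ((Units.val ((u : ↥(unitaryGroupOfForm (conjLocal L (IsCMField.complexConj L) v) (cmLocalForm L 2 v))) : GL (Fin 2) (LocalRing L v)) 0 1) w') := by
      rw [unitModulusChar_localRing_eq_prod, hb.unit_spec]
    have hle : A₀ ≤ unitModulusChar (LocalRing L v) hb.unit := by
      rw [← NNReal.coe_le_coe, hmod]; linarith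
    rw [hA₀ u hb hle, coe_inv_halfModulusChar_eq_inv_sqrt L v hb]
    beta_reduce
    rw [dif_pos hb, smul_eq_mul]
    ring
  -- `Q² = ‖σ(α) α‖`, the module of a norm (★ `distribHaarChar_map_eq`)
  have hnorm : ∀ β : (LocalRing L v)ˣ, (distribHaarChar (LocalRing L v)
      (Units.map (conjLocal L (IsCMField.complexConj L) v : LocalRing L v →* LocalRing L v) β * β) : ℝ) = (distribHaarChar (LocalRing L v) β : ℝ) ^ 2 := by
    intro β
    rw [map_mul, HeisRing.distribHaarChar_map_eq (conjLocal L (IsCMField.complexConj L) v) hσ hσc β, NNReal.coe_mul, sq]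
  rcases lt_trichotomy (distribHaarChar (LocalRing L v) α) 1 with hQ | hQ | hQ
  · -- `Q < 1`: the difference is `+ ∫_{A < nrm ≤ A/Q²}`, the annulus of the norm `σ(α⁻¹) α⁻¹` (module `Q⁻² > 1`) at `B = A/Q²`
    have hAB : A ≤ A / (distribHaarChar (LocalRing L v) α : ℝ) ^ 2 := by
      rw [le_div_iff₀ (pow_pos hQpos 2)]
      have hQ1 : (distribHaarChar (LocalRing L v) α : ℝ) ^ 2 ≤ 1 := pow_le_one₀ hQpos.le (by exact_mod_cast hQ.le)
      nlinarith
    have hc' : 1 < distribHaarChar (LocalRing L v)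
        (Units.map (conjLocal L (IsCMField.complexConj L) v : LocalRing L v →* LocalRing L v) α⁻¹ * α⁻¹) := by
      rw [← NNReal.coe_lt_coe, NNReal.coe_one, hnorm α⁻¹, map_inv, NNReal.coe_inv, inv_pow]
      exact (one_lt_inv₀ (pow_pos hQpos 2)).2 (by
        have : (distribHaarChar (LocalRing L v) α : ℝ) < 1 := by exact_mod_cast hQ
        nlinarith)
    have hI : A / (distribHaarChar (LocalRing L v) α : ℝ) ^ 2 / (distribHaarChar (LocalRing L v)
        (Units.map (conjLocal L (IsCMField.complexConj L) v : LocalRing L v →* LocalRing L v) α⁻¹ * α⁻¹) : ℝ) = A := by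
      rw [hnorm α⁻¹, map_inv, NNReal.coe_inv, inv_pow, div_inv_eq_mul, div_mul_cancel₀ A (pow_pos hQpos 2).ne']
    rw [setIntegral_ball_sub_setIntegral_ball_of_ge μ hν _ hAB (hF.continuousOn.integrableOn_compact (hK _))]
    have hset : (fun u : ↥(cmBorelTriple L 2 v).N => ((∏ w' : PlacesOver L v, normAbs (w'.1.adicCompletion L)
        ((Units.val ((u : ↥(unitaryGroupOfForm (conjLocal L (IsCMField.complexConj L) v) (cmLocalForm L 2 v))) : GL (Fin 2) (LocalRing L v)) 0 1) w') : ℝ≥0) : ℝ)) ⁻¹'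
          Set.Ioc A (A / (distribHaarChar (LocalRing L v) α : ℝ) ^ 2) =
        (fun u : ↥(cmBorelTriple L 2 v).N =>
          Units.val ((u : ↥(unitaryGroupOfForm (conjLocal L (IsCMField.complexConj L) v) (cmLocalForm L 2 v))) : GL (Fin 2) (LocalRing L v)) 0 1) ⁻¹'
          ((fun b : LocalRing L v => ((∏ w' : PlacesOver L v, normAbs (w'.1.adicCompletion L) (b w') : ℝ≥0) : ℝ)) ⁻¹'
            Set.Ioc (A / (distribHaarChar (LocalRing L v) α : ℝ) ^ 2 / (distribHaarChar (LocalRing L v)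
              (Units.map (conjLocal L (IsCMField.complexConj L) v : LocalRing L v →* LocalRing L v) α⁻¹ * α⁻¹) : ℝ))
              (A / (distribHaarChar (LocalRing L v) α : ℝ) ^ 2)) := by
      rw [hI]; rfl
    rw [hset, setIntegral_preimage_eq_integral_indicator_comp μ _ hz.measurable ((measurable_prod_normAbs L v).coe_nnreal_real measurableSet_Ioc)
      (fun b : LocalRing L v => (((χ₂ ⟨-1, neg_one_mem_normOneUnits (conjLocal L (IsCMField.complexConj L) v)⟩ : ℂˣ) : ℂ) * f.toFun 1) •
          ((((NNReal.sqrt (∏ w' : PlacesOver L v, normAbs (w'.1.adicCompletion L) (b w')))⁻¹ : ℝ≥0) : ℂ) *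
            (fun b : LocalRing L v => if hb : IsUnit b then
              (((χ₁ (Units.map (conjLocal L (IsCMField.complexConj L) v : LocalRing L v →* LocalRing L v) hb.unit))⁻¹ : ℂˣ) : ℂ) else 0) b))
      (fun u hu => hfar u (le_trans (by rw [hI]; exact hA1) (le_of_lt hu.1)))]
    rw [integral_indicator_const_smul_comp, integral_annulus_tail_eq_zero_of_norm_two L v w hw χ₁ hns h₁ hq μ α⁻¹ hc' hAQpos, smul_zero]
  · -- `Q = 1`
    rw [hQ, NNReal.coe_one, one_pow, div_one, sub_self]
  · -- `1 < Q`: the difference is `−∫_{A/Q² < nrm ≤ A}`, the annulus of the norm `σ(α) α` (module `Q² > 1`) at `A`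
    have hBA : A / (distribHaarChar (LocalRing L v) α : ℝ) ^ 2 ≤ A :=
      div_le_self hApos.le (one_le_pow₀ (by exact_mod_cast hQ.le))
    have hc : 1 < distribHaarChar (LocalRing L v)
        (Units.map (conjLocal L (IsCMField.complexConj L) v : LocalRing L v →* LocalRing L v) α * α) := by
      rw [← NNReal.coe_lt_coe, NNReal.coe_one, hnorm α]
      have : (1 : ℝ) < (distribHaarChar (LocalRing L v) α : ℝ) := by exact_mod_cast hQ
      nlinarith
    rw [setIntegral_ball_sub_setIntegral_ball_of_le μ hν _ hBA (hF.continuousOn.integrableOn_compact (hK _))]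
    have hset : (fun u : ↥(cmBorelTriple L 2 v).N => ((∏ w' : PlacesOver L v, normAbs (w'.1.adicCompletion L)
        ((Units.val ((u : ↥(unitaryGroupOfForm (conjLocal L (IsCMField.complexConj L) v) (cmLocalForm L 2 v))) : GL (Fin 2) (LocalRing L v)) 0 1) w') : ℝ≥0) : ℝ)) ⁻¹'
          Set.Ioc (A / (distribHaarChar (LocalRing L v) α : ℝ) ^ 2) A =
        (fun u : ↥(cmBorelTriple L 2 v).N =>
          Units.val ((u : ↥(unitaryGroupOfForm (conjLocal L (IsCMField.complexConj L) v) (cmLocalForm L 2 v))) : GL (Fin 2) (LocalRing L v)) 0 1) ⁻¹'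
          ((fun b : LocalRing L v => ((∏ w' : PlacesOver L v, normAbs (w'.1.adicCompletion L) (b w') : ℝ≥0) : ℝ)) ⁻¹'
            Set.Ioc (A / (distribHaarChar (LocalRing L v)
              (Units.map (conjLocal L (IsCMField.complexConj L) v : LocalRing L v →* LocalRing L v) α * α) : ℝ)) A) := by
      rw [hnorm α]; rfl
    rw [hset, setIntegral_preimage_eq_integral_indicator_comp μ _ hz.measurable ((measurable_prod_normAbs L v).coe_nnreal_real measurableSet_Ioc)
      (fun b : LocalRing L v => (((χ₂ ⟨-1, neg_one_mem_normOneUnits (conjLocal L (IsCMField.complexConj L) v)⟩ : ℂˣ) : ℂ) * f.toFun 1) •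
          ((((NNReal.sqrt (∏ w' : PlacesOver L v, normAbs (w'.1.adicCompletion L) (b w')))⁻¹ : ℝ≥0) : ℂ) *
            (fun b : LocalRing L v => if hb : IsUnit b then
              (((χ₁ (Units.map (conjLocal L (IsCMField.complexConj L) v : LocalRing L v →* LocalRing L v) hb.unit))⁻¹ : ℂˣ) : ℂ) else 0) b))
      (fun u hu => hfar u (le_trans (by rw [hnorm α]; exact hAQ) (le_of_lt hu.1)))]
    rw [integral_indicator_const_smul_comp, integral_annulus_tail_eq_zero_of_norm_two L v w hw χ₁ hns h₁ hq μ α hc hApos, smul_zero, neg_zero]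

end Summit.HodgeConjecture.HodgeConjecture.R90.S4

end
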